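import Summits.QuantumAdvantage.QuantumAdvantage.Theorems.CubicForrelationNearExactIsExactTwelveLevelSixOffFlat200A1

/-!
# Crux `CubicForrelation.NearExactIsExact` (stmt-QuantumAdvantage-14043) — n = 12, level ≥ 6: the residual off the 9-flat at off-flat energy
  `≤ 200` (one step past gen 18's `≤ 192`), part A: the case of a round-1 bad coset

Certificate seat `b2b-cforr-cert` (gen 18).  HONEST FRAMING: a lemma (standard axioms) for the level-`≥ 6` branch of "is `935/1024` attained at
`n = 12`?" (total budget `Σ e² ≤ 712`, off-flat energy `≤ 200`); finite-slice bookkeeping, NOT summit progress.  It is `tw18_off_flat_bad1_192`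
with `8` more units of energy: a bad coset may now carry up to `34` points with `8 ∤ e`, and up to `50` exceptional points of cost `4` fit; whenever
gen 15's shape (two cosets, `≤ 31` bad points each) fails, at least `48` exceptional points lie in three cosets and `tw18_rigid_pack200` makes the
configuration RIGID (`e = ±2` on at most `50` points, `e = 0` elsewhere off `Z`).

`tw18_off_flat_bad1_200`: cubic `f, g`, `W_g = 64u''`, `Z = {u'' even} = x_Z ⊕ V₀`, `e = u'' − (−1)^f`, `Σ_{x ∉ Z} e² ≤ 200`, and some point off
`Z` has `e/2` odd.  Then EITHER the off-flat energy is `≥ 128` and the points with `8 ∤ e` lie in two distinct cosets (`≠ Z`), at most `31` in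
each; OR (RIGID) the energy is `≥ 192` and `Ω = {y ∉ Z : 8 ∤ e(y)}` has at most `50` points, all with `e² = 4`, inside three pairwise distinct
cosets `≠ Z`.

References: J. Ax (1964) / R. J. McEliece (1972); MacWilliams–Sloane (1977) Ch. 13 §3.  Axioms: the standard three.
-/



set_option linter.dupNamespace false -- D-0017: single-problem summit ⇒ `QuantumAdvantage.QuantumAdvantage` by design

noncomputable section

namespace Summit.QuantumAdvantage.QuantumAdvantage.Theorems.CubicForrelation.NearExactIsExact

open Finset
open Literature.Computability.QuantumComplexity
open Literature.Computability.QuantumComplexity.BuzetChailloux (bxor zeroVec bxor_bxor_cancel_left bxor_zeroVec zeroVec_bxor bxor_comm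
  bxor_self)
open Literature.Computability.QuantumComplexity.DerivativeWalsh (W)

/-! ### The residual off the 9-flat, energy `≤ 200`: the case of a round-1 bad coset -/

/-- **Off the flat at energy `≤ 200`, when some point off `Z` has `e/2` odd: a sparse two-coset exception, or a RIGID exception.**  See the
module docstring (part A of `tw18_off_flat_le200`). [this work] -/
theorem tw18_off_flat_bad1_200 (f g : (Fin (6 + 6) → Bool) → Bool) (hf : IsDegLeFun 3 f) (hg : IsDegLeFun 3 g)
    (u'' : (Fin (6 + 6) → Bool) → ℤ) (hu'' : ∀ x, W (fun y => signOf (g y)) x = (2 : ℝ) ^ 6 * (u'' x : ℝ))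
    (V₀ : Finset (Fin (6 + 6) → Bool)) (xZ : Fin (6 + 6) → Bool) (h0 : zeroVec ∈ V₀)
    (hadd : ∀ a ∈ V₀, ∀ b ∈ V₀, bxor a b ∈ V₀) (hcardV9 : #V₀ = 2 ^ 9)
    (hS : (univ.filter fun x : Fin (6 + 6) → Bool => ¬ Odd (u'' x)) = V₀.image (bxor xZ))
    (hoff_le : ∑ x ∈ univ.filter (fun x => x ∉ (univ.filter fun x : Fin (6 + 6) → Bool => ¬ Odd (u'' x))),
      (u'' x - sZ (f x)) ^ 2 ≤ 200)
    (p : Fin (6 + 6) → Bool) (hp : p ∉ (univ.filter fun x : Fin (6 + 6) → Bool => ¬ Odd (u'' x)))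
    (hpodd : Odd ((u'' p - sZ (f p)) / 2)) :
    (∃ y₁ y₂ : Fin (6 + 6) → Bool, y₁ ∉ (univ.filter fun x : Fin (6 + 6) → Bool => ¬ Odd (u'' x)) ∧
      y₂ ∉ (univ.filter fun x : Fin (6 + 6) → Bool => ¬ Odd (u'' x)) ∧ y₂ ∉ V₀.image (bxor y₁) ∧
      (∀ y, y ∉ (univ.filter fun x : Fin (6 + 6) → Bool => ¬ Odd (u'' x)) → y ∉ V₀.image (bxor y₁) → y ∉ V₀.image (bxor y₂) →
        (8 : ℤ) ∣ u'' y - sZ (f y)) ∧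
      #((V₀.image (bxor y₁)).filter fun y => ¬ (8 : ℤ) ∣ u'' y - sZ (f y)) ≤ 31 ∧
      #((V₀.image (bxor y₂)).filter fun y => ¬ (8 : ℤ) ∣ u'' y - sZ (f y)) ≤ 31 ∧
      128 ≤ ∑ x ∈ univ.filter (fun x => x ∉ (univ.filter fun x : Fin (6 + 6) → Bool => ¬ Odd (u'' x))), (u'' x - sZ (f x)) ^ 2) ∨
    (∃ y₁ y₂ y₃ : Fin (6 + 6) → Bool, y₁ ∉ (univ.filter fun x : Fin (6 + 6) → Bool => ¬ Odd (u'' x)) ∧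
      y₂ ∉ (univ.filter fun x : Fin (6 + 6) → Bool => ¬ Odd (u'' x)) ∧ y₃ ∉ (univ.filter fun x : Fin (6 + 6) → Bool => ¬ Odd (u'' x)) ∧
      y₂ ∉ V₀.image (bxor y₁) ∧ y₃ ∉ V₀.image (bxor y₁) ∧ y₃ ∉ V₀.image (bxor y₂) ∧
      (∀ ω ∈ univ.filter (fun ω => ω ∉ (univ.filter fun x : Fin (6 + 6) → Bool => ¬ Odd (u'' x)) ∧ ¬ (8 : ℤ) ∣ u'' ω - sZ (f ω)),
        ω ∈ V₀.image (bxor y₁) ∨ ω ∈ V₀.image (bxor y₂) ∨ ω ∈ V₀.image (bxor y₃)) ∧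
      #(univ.filter (fun ω => ω ∉ (univ.filter fun x : Fin (6 + 6) → Bool => ¬ Odd (u'' x)) ∧ ¬ (8 : ℤ) ∣ u'' ω - sZ (f ω))) ≤ 50 ∧
      (∀ ω ∈ univ.filter (fun ω => ω ∉ (univ.filter fun x : Fin (6 + 6) → Bool => ¬ Odd (u'' x)) ∧ ¬ (8 : ℤ) ∣ u'' ω - sZ (f ω)),
        (u'' ω - sZ (f ω)) ^ 2 = 4) ∧
      192 ≤ ∑ x ∈ univ.filter (fun x => x ∉ (univ.filter fun x : Fin (6 + 6) → Bool => ¬ Odd (u'' x))), (u'' x - sZ (f x)) ^ 2) := by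
  classical
  set Z := univ.filter (fun x : Fin (6 + 6) → Bool => ¬ Odd (u'' x)) with hZdef
  have hmemZ : ∀ x, x ∈ Z ↔ ¬ Odd (u'' x) := fun x => by simp [hZdef]
  set e : (Fin (6 + 6) → Bool) → ℤ := fun x => u'' x - sZ (f x) with hedef
  show (∃ y₁ y₂ : Fin (6 + 6) → Bool, y₁ ∉ Z ∧ y₂ ∉ Z ∧ y₂ ∉ V₀.image (bxor y₁) ∧
      (∀ y, y ∉ Z → y ∉ V₀.image (bxor y₁) → y ∉ V₀.image (bxor y₂) → (8 : ℤ) ∣ e y) ∧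
      #((V₀.image (bxor y₁)).filter fun y => ¬ (8 : ℤ) ∣ e y) ≤ 31 ∧ #((V₀.image (bxor y₂)).filter fun y => ¬ (8 : ℤ) ∣ e y) ≤ 31 ∧
      128 ≤ ∑ x ∈ univ.filter (fun x => x ∉ Z), e x ^ 2) ∨
    (∃ y₁ y₂ y₃ : Fin (6 + 6) → Bool, y₁ ∉ Z ∧ y₂ ∉ Z ∧ y₃ ∉ Z ∧
      y₂ ∉ V₀.image (bxor y₁) ∧ y₃ ∉ V₀.image (bxor y₁) ∧ y₃ ∉ V₀.image (bxor y₂) ∧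
      (∀ ω ∈ univ.filter (fun ω => ω ∉ Z ∧ ¬ (8 : ℤ) ∣ e ω), ω ∈ V₀.image (bxor y₁) ∨ ω ∈ V₀.image (bxor y₂) ∨ ω ∈ V₀.image (bxor y₃)) ∧
      #(univ.filter (fun ω => ω ∉ Z ∧ ¬ (8 : ℤ) ∣ e ω)) ≤ 50 ∧
      (∀ ω ∈ univ.filter (fun ω => ω ∉ Z ∧ ¬ (8 : ℤ) ∣ e ω), e ω ^ 2 = 4) ∧
      192 ≤ ∑ x ∈ univ.filter (fun x => x ∉ Z), e x ^ 2)
  change p ∉ Z at hp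
  change Odd (e p / 2) at hpodd
  have heeven : ∀ x, x ∉ Z → Even (e x) := by
    intro x hx
    have hodd : Odd (u'' x) := not_not.1 fun h => hx ((hmemZ x).2 h)
    rcases tp_sZ_cases (f x) with hs | hs <;> simp only [e] <;> rw [hs] <;>
      exact Int.even_sub.2 (iff_of_false (Int.not_even_iff_odd.2 hodd) (by decide))
  have hPV' : ∀ x, x ∉ Z → ∀ a ∈ V₀, bxor x a ∉ Z := fun x hx a ha => fl1_coset_out' hadd hS hx ha
  -- flat sums of `e`: `4 ∣` on 6-flats, `8 ∣` on 7-flats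
  have hflat6 : ∀ (b : Fin (6 + 6) → Bool) (a : Fin 6 → Fin (6 + 6) → Bool),
      (4 : ℤ) ∣ ∑ ε : Fin 6 → Bool, e (fun j => b j ^^ decide (Odd #(univ.filter fun i => ε i && a i j))) :=
    fun b a => tw15_e_flat6 f g hf hg u'' hu'' b a
  have hflat7 : ∀ (b : Fin (6 + 6) → Bool) (a : Fin 7 → Fin (6 + 6) → Bool),
      (8 : ℤ) ∣ ∑ ε : Fin 7 → Bool, e (fun j => b j ^^ decide (Odd #(univ.filter fun i => ε i && a i j))) :=
    fun b a => tw15_e_flat7 f g hf hg u'' hu'' b a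
  -- OFF-Z KILL, round 1: `4 ∣ e` off `Z`
  have hcos_out : ∀ p, p ∉ Z → ∀ b ∈ V₀.image (bxor p), b ∉ Z := by
    intro p hp b hb
    obtain ⟨v, hv, rfl⟩ := mem_image.1 hb
    exact hPV' p hp v hv
  have hoff_count : ∀ (T : Finset (Fin (6 + 6) → Bool)) (c : ℤ), (∀ x ∈ T, x ∉ Z) → (∀ x ∈ T, c ≤ e x ^ 2) →
      c * #T ≤ 200 := by
    intro T c hT hc
    calc c * #T = ∑ x ∈ T, c := by rw [sum_const, nsmul_eq_mul, mul_comm]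
      _ ≤ ∑ x ∈ T, e x ^ 2 := sum_le_sum hc
      _ ≤ ∑ x ∈ univ.filter (fun x => x ∉ Z), e x ^ 2 :=
          sum_le_sum_of_subset_of_nonneg (fun x hx => mem_filter.2 ⟨mem_univ _, hT x hx⟩) fun x _ _ => sq_nonneg _
      _ ≤ 200 := hoff_le
  have hxZ : xZ ∈ Z := by rw [hS]; exact mem_image.2 ⟨zeroVec, h0, bxor_zeroVec xZ⟩
  have hPV : ∀ x, x ∈ Z → ∀ a ∈ V₀, bxor x a ∈ Z := fun x hx a ha => fl1_coset_vadd hadd hS hx ha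
  have hp2 : ∀ y, y ∉ Z → e y = 2 * (e y / 2) := fun y hy =>
    (Int.mul_ediv_cancel' (even_iff_two_dvd.1 (heeven y hy))).symm
  have hcost4 : ∀ x, x ∉ Z → Odd (e x / 2) → 4 ≤ e x ^ 2 := by
    intro x hx hodd
    have h0' := Int.odd_iff.1 hodd
    have h2 := hp2 x hx
    have : e x ≤ -2 ∨ 2 ≤ e x := by omega
    have := tp_sq_ge (k := 2) (by norm_num) this
    linarith
  -- round 1a: in a coset `p ⊕ V₀` (`p ∉ Z`) `e/2` is even, or odd at `≥ 16` points (6-flat parity + Reed–Muller on the abstract flat)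
  have hdich : ∀ p, p ∉ Z → (∀ x ∈ V₀.image (bxor p), Even (e x / 2)) ∨
      16 ≤ #((V₀.image (bxor p)).filter fun x => Odd (e x / 2)) := by
    intro p hp
    rcases ws_erm_round V₀ h0 hadd hcardV9 p (fun y => e y / 2) 5 (fun b hb a ha => by
        have hpts : ∀ ε : Fin (5 + 1) → Bool, (fun j => b j ^^ decide (Odd #(univ.filter fun i => ε i && a i j))) ∉ Z :=
          fun ε => ws_flatPt_mem V₀ h0 (· ∉ Z) hPV' (5 + 1) b (hcos_out p hp b hb) a ha ε
        have h4 := hflat6 b a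
        rw [sum_congr rfl fun ε _ => hp2 _ (hpts ε), ← mul_sum] at h4
        obtain ⟨k, hk⟩ := h4
        exact ⟨k, by linarith⟩) with hev | hbig
    · exact Or.inl hev
    · right; norm_num at hbig; omega
  have hbad_of_odd : ∀ p, p ∉ Z → Odd (e p / 2) → 16 ≤ #((V₀.image (bxor p)).filter fun x => Odd (e x / 2)) := by
    intro p hp hpodd
    refine (hdich p hp).resolve_left fun h => ?_
    exact (Int.not_even_iff_odd.2 hpodd) (h p (mem_image.2 ⟨zeroVec, h0, bxor_zeroVec p⟩))
  -- a nonzero even value costs `≥ 4`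
  have hcost4' : ∀ x, x ∉ Z → e x ≠ 0 → 4 ≤ e x ^ 2 := by
    intro x hx hne
    obtain ⟨k, hk⟩ := heeven x hx
    have hk0 : k ≠ 0 := by rintro rfl; exact hne (by rw [hk]; ring)
    have : e x ≤ -2 ∨ 2 ≤ e x := by omega
    have := tp_sq_ge (k := 2) (by norm_num) this
    linarith
  have hsymm : ∀ q x : Fin (6 + 6) → Bool, x ∈ V₀.image (bxor q) → q ∈ V₀.image (bxor x) := by
    intro q x hx
    obtain ⟨v, hv, hvx⟩ := mem_image.1 hx
    exact mem_image.2 ⟨v, hv, by rw [← hvx, iw_bxor_assoc, bxor_self, bxor_zeroVec]⟩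
  have hchain : ∀ q x w : Fin (6 + 6) → Bool, x ∈ V₀.image (bxor q) → w ∈ V₀.image (bxor x) → w ∈ V₀.image (bxor q) := by
    intro q x w hx hw
    obtain ⟨v, hv, hvx⟩ := mem_image.1 hx
    obtain ⟨v', hv', hv'w⟩ := mem_image.1 hw
    exact mem_image.2 ⟨bxor v v', hadd v hv v' hv', by rw [← hv'w, ← hvx, iw_bxor_assoc]⟩
  -- round 2 dichotomy ON A COSET where `4 ∣ e`: `e/4` is even there, or odd at `≥ 8` points (7-flat parity + Reed–Muller)
  have hcost16 : ∀ x, x ∉ Z → (4 : ℤ) ∣ e x → Odd (e x / 4) → 16 ≤ e x ^ 2 := by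
    intro x _ h4 hodd
    have h0' := Int.odd_iff.1 hodd
    have h2 := (Int.mul_ediv_cancel' h4).symm
    have : e x ≤ -4 ∨ 4 ≤ e x := by omega
    have := tp_sq_ge (k := 4) (by norm_num) this
    linarith
  have hdich4q : ∀ q, q ∉ Z → (∀ x ∈ V₀.image (bxor q), (4 : ℤ) ∣ e x) →
      (∀ x ∈ V₀.image (bxor q), Even (e x / 4)) ∨ 8 ≤ #((V₀.image (bxor q)).filter fun x => Odd (e x / 4)) := by
    intro q hq h4
    have hPVq : ∀ x, x ∈ V₀.image (bxor q) → ∀ a ∈ V₀, bxor x a ∈ V₀.image (bxor q) :=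
      fun x hx a ha => fl1_coset_vadd hadd rfl hx ha
    rcases ws_erm_round V₀ h0 hadd hcardV9 q (fun y => e y / 4) 6 (fun b hb a ha => by
        have hpts : ∀ ε : Fin (6 + 1) → Bool, (fun j => b j ^^ decide (Odd #(univ.filter fun i => ε i && a i j))) ∈ V₀.image (bxor q) :=
          fun ε => ws_flatPt_mem V₀ h0 (· ∈ V₀.image (bxor q)) hPVq (6 + 1) b hb a ha ε
        have h8 := hflat7 b a
        rw [sum_congr rfl fun ε _ => (Int.mul_ediv_cancel' (h4 _ (hpts ε))).symm, ← mul_sum] at h8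
        obtain ⟨k, hk⟩ := h8
        exact ⟨k, by linarith⟩) with hev | hbig
    · exact Or.inl hev
    · right; norm_num at hbig; omega
  have hbad := hbad_of_odd p hp hpodd
  by_cases htwo : ∃ z, z ∉ Z ∧ z ∉ V₀.image (bxor p) ∧ Odd (e z / 2)
  · /- TWO bad cosets: the sparse exception -/
    obtain ⟨z, hz, hzC, hzodd⟩ := htwo
    have hCz := hbad_of_odd z hz hzodd
    have hpCz : p ∉ V₀.image (bxor z) := fun h => hzC (hsymm z p h)
    -- capacity: a coset off `Z` disjoint from a bad coset has at most `200/4 − 16 = 34` non-multiples of `8`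
    have hcap : ∀ q q' : Fin (6 + 6) → Bool, q ∉ Z → q' ∉ Z → q' ∉ V₀.image (bxor q) →
        16 ≤ #((V₀.image (bxor q')).filter fun x => Odd (e x / 2)) →
        #((V₀.image (bxor q)).filter fun y => ¬ (8 : ℤ) ∣ e y) ≤ 34 := by
      intro q q' hq hq' hq'C h16
      set A := (V₀.image (bxor q)).filter (fun y => ¬ (8 : ℤ) ∣ e y) with hA
      set B := (V₀.image (bxor q')).filter (fun x => Odd (e x / 2)) with hB
      have hdisjAB : Disjoint A B := by
        rw [disjoint_left]
        intro x hxA hxB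
        exact hq'C (hchain q x q' (mem_filter.1 hxA).1 (hsymm q' x (mem_filter.1 hxB).1))
      have hsubAB : A ∪ B ⊆ univ.filter (fun x => x ∉ Z) := by
        intro x hx
        rcases mem_union.1 hx with h | h
        · exact mem_filter.2 ⟨mem_univ _, hcos_out q hq x (mem_filter.1 h).1⟩
        · exact mem_filter.2 ⟨mem_univ _, hcos_out q' hq' x (mem_filter.1 h).1⟩
      have h1 : ∑ x ∈ A ∪ B, (4 : ℤ) ≤ ∑ x ∈ A ∪ B, e x ^ 2 := sum_le_sum fun x hx => by
        rcases mem_union.1 hx with h | h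
        · exact hcost4' x (hcos_out q hq x (mem_filter.1 h).1) (fun h0 => (mem_filter.1 h).2 (by rw [h0]; exact dvd_zero _))
        · exact hcost4 x (hcos_out q' hq' x (mem_filter.1 h).1) (mem_filter.1 h).2
      have h2 := sum_le_sum_of_subset_of_nonneg hsubAB (f := fun x => e x ^ 2) fun x _ _ => sq_nonneg _
      rw [sum_const, nsmul_eq_mul, card_union_of_disjoint hdisjAB] at h1
      push_cast at h1
      have h16' : (16 : ℤ) ≤ #B := by exact_mod_cast h16
      have hA34 : (#A : ℤ) ≤ 34 := by linarith
      exact_mod_cast hA34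
    set Bp := (V₀.image (bxor p)).filter (fun x => Odd (e x / 2)) with hBp
    set Bz := (V₀.image (bxor z)).filter (fun x => Odd (e x / 2)) with hBz
    have hdisj : Disjoint Bp Bz := by
      rw [disjoint_left]
      intro x hxp hxz
      exact hzC (hchain p x z (mem_filter.1 hxp).1 (hsymm z x (mem_filter.1 hxz).1))
    -- energy: the two bad sets already cost `128`
    have hBsum : (128 : ℤ) ≤ ∑ x ∈ Bp ∪ Bz, e x ^ 2 := by
      have h1 : ∑ x ∈ Bp ∪ Bz, (4 : ℤ) ≤ ∑ x ∈ Bp ∪ Bz, e x ^ 2 := sum_le_sum fun x hx => by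
        rcases mem_union.1 hx with h | h
        · exact hcost4 x (hcos_out p hp x (mem_filter.1 h).1) (mem_filter.1 h).2
        · exact hcost4 x (hcos_out z hz x (mem_filter.1 h).1) (mem_filter.1 h).2
      rw [sum_const, nsmul_eq_mul, card_union_of_disjoint hdisj] at h1
      push_cast at h1
      have h16p : (16 : ℤ) ≤ #Bp := by exact_mod_cast hbad
      have h16z : (16 : ℤ) ≤ #Bz := by exact_mod_cast hCz
      linarith
    have hBsub : Bp ∪ Bz ⊆ univ.filter (fun x => x ∉ Z) := by
      intro x hx
      rcases mem_union.1 hx with h | h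
      · exact mem_filter.2 ⟨mem_univ _, hcos_out p hp x (mem_filter.1 h).1⟩
      · exact mem_filter.2 ⟨mem_univ _, hcos_out z hz x (mem_filter.1 h).1⟩
    have hBle : ∑ x ∈ Bp ∪ Bz, e x ^ 2 ≤ ∑ x ∈ univ.filter (fun x => x ∉ Z), e x ^ 2 :=
      sum_le_sum_of_subset_of_nonneg hBsub fun x _ _ => sq_nonneg _
    -- odd points are not multiples of `8`; `8 ∤ e` off `Z` means `e² = 4` or `e² ≥ 16`; `8 ∤ e` fails only at `e = 0` or `|e| ≥ 8`
    have hodd8 : ∀ x, x ∉ Z → Odd (e x / 2) → ¬ (8 : ℤ) ∣ e x := by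
      intro x hx hxodd h8
      obtain ⟨m, hm⟩ := h8
      have h2 := hp2 x hx
      have : e x / 2 = 4 * m := by omega
      rw [this] at hxodd
      exact (Int.not_even_iff_odd.2 hxodd) ⟨2 * m, by ring⟩
    have hval8 : ∀ x, x ∉ Z → ¬ (8 : ℤ) ∣ e x → e x ^ 2 = 4 ∨ 16 ≤ e x ^ 2 := by
      intro x hx h8
      obtain ⟨j, hj⟩ := heeven x hx
      have hj0 : j ≠ 0 := by rintro rfl; exact h8 ⟨0, by rw [hj]; ring⟩
      rcases lt_trichotomy j 0 with h | h | h
      · by_cases h1 : j = -1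
        · left; rw [hj, h1]; norm_num
        · right; have : j ≤ -2 := by omega
          rw [hj]; nlinarith
      · exact absurd h hj0
      · by_cases h1 : j = 1
        · left; rw [hj, h1]; norm_num
        · right; have : 2 ≤ j := by omega
          rw [hj]; nlinarith
    have hval4 : ∀ x, x ∉ Z → ¬ Odd (e x / 2) → e x = 0 ∨ 16 ≤ e x ^ 2 := by
      intro x hx hnodd
      obtain ⟨j, hj⟩ := Int.not_odd_iff_even.1 hnodd
      have h2 := hp2 x hx
      have he : e x = 4 * j := by rw [h2, hj]; ring
      by_cases hj0 : j = 0
      · left; rw [he, hj0]; ring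
      · right
        have : j ≤ -1 ∨ 1 ≤ j := by omega
        have := tp_sq_ge (k := 1) (by norm_num) this
        rw [he]; nlinarith
    have hBA : ∀ (q : Fin (6 + 6) → Bool), q ∉ Z → (V₀.image (bxor q)).filter (fun x => Odd (e x / 2)) ⊆
        (V₀.image (bxor q)).filter (fun y => ¬ (8 : ℤ) ∣ e y) := fun q hq x hx =>
      mem_filter.2 ⟨(mem_filter.1 hx).1, hodd8 x (hcos_out q hq x (mem_filter.1 hx).1) (mem_filter.1 hx).2⟩
    -- the rigid packaging: `≥ 48` exceptional points inside three cosets exhaust the energy up to `8`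
    have hrigid : ∀ (U : Finset (Fin (6 + 6) → Bool)) (y₃ : Fin (6 + 6) → Bool), y₃ ∉ Z → y₃ ∉ V₀.image (bxor p) →
        y₃ ∉ V₀.image (bxor z) → (∀ x ∈ U, x ∉ Z) → (∀ x ∈ U, ¬ (8 : ℤ) ∣ e x) → 48 ≤ #U →
        (∀ x ∈ U, x ∈ V₀.image (bxor p) ∨ x ∈ V₀.image (bxor z) ∨ x ∈ V₀.image (bxor y₃)) →
        (∀ x, x ∉ Z → x ∉ U → e x = 0 ∨ 16 ≤ e x ^ 2) →
        (∃ y₁ y₂ y₃ : Fin (6 + 6) → Bool, y₁ ∉ Z ∧ y₂ ∉ Z ∧ y₃ ∉ Z ∧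
          y₂ ∉ V₀.image (bxor y₁) ∧ y₃ ∉ V₀.image (bxor y₁) ∧ y₃ ∉ V₀.image (bxor y₂) ∧
          (∀ ω ∈ univ.filter (fun ω => ω ∉ Z ∧ ¬ (8 : ℤ) ∣ e ω),
            ω ∈ V₀.image (bxor y₁) ∨ ω ∈ V₀.image (bxor y₂) ∨ ω ∈ V₀.image (bxor y₃)) ∧
          #(univ.filter (fun ω => ω ∉ Z ∧ ¬ (8 : ℤ) ∣ e ω)) ≤ 50 ∧
          (∀ ω ∈ univ.filter (fun ω => ω ∉ Z ∧ ¬ (8 : ℤ) ∣ e ω), e ω ^ 2 = 4) ∧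
          192 ≤ ∑ x ∈ univ.filter (fun x => x ∉ Z), e x ^ 2) := by
      intro U y₃ hy₃ hy₃p hy₃z hUZ hU8 hU48 hUC hout
      have hU4 : ∀ x ∈ U, e x ^ 2 = 4 ∨ 16 ≤ e x ^ 2 := fun x hx => hval8 x (hUZ x hx) (hU8 x hx)
      obtain ⟨h1, h2, h3, h4⟩ := tw18_rigid_pack200 e Z U (V₀.image (bxor p)) (V₀.image (bxor z)) (V₀.image (bxor y₃))
        hUZ hU4 hU48 hUC hout hoff_le
      exact ⟨p, z, y₃, hp, hz, hy₃, hzC, hy₃p, hy₃z, h1, h2, h3, h4⟩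
    set Ap := (V₀.image (bxor p)).filter (fun y => ¬ (8 : ℤ) ∣ e y) with hAp
    set Az := (V₀.image (bxor z)).filter (fun y => ¬ (8 : ℤ) ∣ e y) with hAz
    have hBp' : #Bp ≤ #Ap := card_le_card (hBA p hp)
    have hBz' : #Bz ≤ #Az := card_le_card (hBA z hz)
    have hdisjA : Disjoint Ap Az := by
      rw [disjoint_left]
      intro x hxp hxz
      exact hzC (hchain p x z (mem_filter.1 hxp).1 (hsymm z x (mem_filter.1 hxz).1))
    by_cases h3 : ∃ y, y ∉ Z ∧ y ∉ V₀.image (bxor p) ∧ y ∉ V₀.image (bxor z) ∧ Odd (e y / 2)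
    · /- THREE bad cosets: rigid (`tw18_off_flat_three_200`) -/
      obtain ⟨y, hy, hyp, hyz, hyodd⟩ := h3
      right
      exact tw18_off_flat_three_200 f g hf hg u'' hu'' V₀ xZ h0 hadd hcardV9 hS hoff_le p hp hpodd z hz hzC hzodd y hy hyp hyz hyodd
    -- no third bad coset: a point with `e/2` odd lies in `Bp ∪ Bz`
    have hno3 : ∀ y, y ∉ Z → Odd (e y / 2) → y ∈ Bp ∪ Bz := by
      intro y hy hyodd
      by_contra hyB
      have hyp : y ∉ V₀.image (bxor p) := fun h => hyB (mem_union.2 (Or.inl (mem_filter.2 ⟨h, hyodd⟩)))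
      have hyz : y ∉ V₀.image (bxor z) := fun h => hyB (mem_union.2 (Or.inr (mem_filter.2 ⟨h, hyodd⟩)))
      exact h3 ⟨y, hy, hyp, hyz, hyodd⟩
    -- outside the two bad cosets `8 ∣ e`: such a point has `e/2` even, and `e/4` odd would make its own coset carry `≥ 8` points of
    -- cost `16` (round-2 dichotomy on that coset), `128 + 128 > E`
    have h8 : ∀ y, y ∉ Z → y ∉ V₀.image (bxor p) → y ∉ V₀.image (bxor z) → (8 : ℤ) ∣ e y := by
      intro y hy hyp hyz
      have hout4 : ∀ x ∈ V₀.image (bxor y), (4 : ℤ) ∣ e x := by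
        intro x hx
        have hxZ : x ∉ Z := hcos_out y hy x hx
        have hxB : x ∉ Bp ∪ Bz := by
          intro h
          rcases mem_union.1 h with h | h
          · exact hyp (hchain p x y (mem_filter.1 h).1 (hsymm y x hx))
          · exact hyz (hchain z x y (mem_filter.1 h).1 (hsymm y x hx))
        have hev : Even (e x / 2) := by
          by_contra hodd
          exact hxB (hno3 x hxZ (Int.not_even_iff_odd.1 hodd))
        obtain ⟨k, hk⟩ := hev
        exact ⟨k, by rw [hp2 x hxZ, hk]; ring⟩
      by_contra hn8
      have hy4 := hout4 y (mem_image.2 ⟨zeroVec, h0, bxor_zeroVec y⟩)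
      have hyodd : Odd (e y / 4) := by
        by_contra hev
        obtain ⟨k, hk⟩ := Int.not_odd_iff_even.1 hev
        exact hn8 ⟨k, by rw [(Int.mul_ediv_cancel' hy4).symm, hk]; ring⟩
      set Cy := (V₀.image (bxor y)).filter (fun x => Odd (e x / 4)) with hCy
      have hC8 : 8 ≤ #Cy := (hdich4q y hy hout4).resolve_left fun h =>
        (Int.not_even_iff_odd.2 hyodd) (h y (mem_image.2 ⟨zeroVec, h0, bxor_zeroVec y⟩))
      have hdisjC : Disjoint (Bp ∪ Bz) Cy := by
        rw [disjoint_left]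
        intro x hx hxy
        rcases mem_union.1 hx with hxp | hxz
        · exact hyp (hchain p x y (mem_filter.1 hxp).1 (hsymm y x (mem_filter.1 hxy).1))
        · exact hyz (hchain z x y (mem_filter.1 hxz).1 (hsymm y x (mem_filter.1 hxy).1))
      have hsubC : (Bp ∪ Bz) ∪ Cy ⊆ univ.filter (fun x => x ∉ Z) := by
        intro x hx
        rcases mem_union.1 hx with h | h
        · exact hBsub h
        · exact mem_filter.2 ⟨mem_univ _, hcos_out y hy x (mem_filter.1 h).1⟩
      have h1 : ∑ x ∈ Cy, (16 : ℤ) ≤ ∑ x ∈ Cy, e x ^ 2 := sum_le_sum fun x hx =>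
        hcost16 x (hcos_out y hy x (mem_filter.1 hx).1) (hout4 x (mem_filter.1 hx).1) (mem_filter.1 hx).2
      rw [sum_const, nsmul_eq_mul] at h1
      have h8C : (8 : ℤ) ≤ #Cy := by exact_mod_cast hC8
      have h2 := sum_le_sum_of_subset_of_nonneg hsubC (f := fun x => e x ^ 2) fun x _ _ => sq_nonneg _
      rw [sum_union hdisjC] at h2
      linarith
    by_cases hcaps : #Ap ≤ 31 ∧ #Az ≤ 31
    · left
      exact ⟨p, z, hp, hz, hzC, h8, hcaps.1, hcaps.2, le_trans hBsum hBle⟩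
    · /- a bad coset with `≥ 32` points not divisible by `8`: rigid -/
      have hcp : #Ap ≤ 34 := hcap p z hp hz hzC hCz
      have hcz : #Az ≤ 34 := hcap z p hz hp hpCz hbad
      -- a third, auxiliary coset
      obtain ⟨d, -, hd⟩ := fl1_avoid univ V₀ [xZ, p, z] (by
        rw [hcardV9, card_univ, Fintype.card_fun, Fintype.card_bool, Fintype.card_fin]; norm_num)
      have hdq : ∀ q ∈ [xZ, p, z], d ∉ V₀.image (bxor q) := by
        intro q hq h
        obtain ⟨v, hv, hvd⟩ := mem_image.1 h
        exact hd q hq (by rw [← hvd, bxor_bxor_cancel_left]; exact hv)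
      have hdZ : d ∉ Z := by rw [hS]; exact hdq xZ (by simp)
      right
      refine hrigid (Ap ∪ Az) d hdZ (hdq p (by simp)) (hdq z (by simp)) (fun x hx => ?_) (fun x hx => ?_) ?_ (fun x hx => ?_)
        (fun x hxZ hxU => ?_)
      · rcases mem_union.1 hx with h | h
        · exact hcos_out p hp x (mem_filter.1 h).1
        · exact hcos_out z hz x (mem_filter.1 h).1
      · rcases mem_union.1 hx with h | h
        · exact (mem_filter.1 h).2
        · exact (mem_filter.1 h).2
      · rw [card_union_of_disjoint hdisjA]
        change 16 ≤ #Bp at hbad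
        change 16 ≤ #Bz at hCz
        rcases not_and_or.1 hcaps with h | h <;> omega
      · rcases mem_union.1 hx with h | h
        · exact Or.inl (mem_filter.1 h).1
        · exact Or.inr (Or.inl (mem_filter.1 h).1)
      · by_cases hxodd : Odd (e x / 2)
        · exfalso
          rcases mem_union.1 (hno3 x hxZ hxodd) with h | h
          · exact hxU (mem_union.2 (Or.inl (hBA p hp h)))
          · exact hxU (mem_union.2 (Or.inr (hBA z hz h)))
        · exact hval4 x hxZ hxodd
  · /- ONE bad coset: excluded by the cross-coset localisation (`tw15_single_bad_coset_false`) -/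
    push Not at htwo
    exact (tw16_single_bad_coset_false 200 (by norm_num) f g hf hg u'' hu'' V₀ xZ h0 hadd hcardV9 hS hoff_le p hp hpodd
      (fun z hz hzC => Int.not_odd_iff_even.1 (htwo z hz hzC))).elim

end Summit.QuantumAdvantage.QuantumAdvantage.Theorems.CubicForrelation.NearExactIsExact

end
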